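import Literature.NumberTheory.EllipticCurves.Kato2004.EulerSystemBoundFineSelmerTwo
import Literature.NumberTheory.EllipticCurves.Kato2004.ValueGuardSatisfiableProofs
import Literature.NumberTheory.EllipticCurves.KatoTwistedFinitenessEulerFactorsProofs
import Literature.NumberTheory.EllipticCurves.KatoTwistedFinitenessTrivialCharacterProofs
import Literature.NumberTheory.EllipticCurves.AnalyticRankOrderProofs
import Literature.NumberTheory.EllipticCurves.KatoFineSelmerDualProofs
import Summits.BirchSwinnertonDyer.Rank1Residual.GaloisImage.KatoKuriharaValueEmptyLevel
import Summits.BirchSwinnertonDyer.Rank1Residual.P2.EmptyCellsAtTwo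
import Summits.BirchSwinnertonDyer.BirchSwinnertonDyer.Theorems.ThetaPartnerAtTwoSignedKatoUpToAtTwoOffTwoFinite
import HarnessLib

/-!
# Route `ThetaPartnerAtTwo` (TP2), crux K3 `SignedKatoDivisibilityUpToAtTwo` (item stmt-BirchSwinnertonDyer-20308),
# line `colemanrat` v3: **NON-VACUITY of the `2`-adic Euler-system side of stubs (C2)/(K2)** — a NON-ZERO genuine
# `2`-adic Λ-adic Euler-system class `s ∈ 𝐇¹_Γ(T₂W)` (`Kato2004.IsEulerSystemClassTwo W hκ I s ∧ s ≠ 0`) EXISTS on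
# the theta habitat (indeed for every `W/ℚ` with `W[2]` irreducible and `L(W,1) ≠ 0`), GRANTED Kato's construction
# fact `Kato2004.exists_eulerSystem_expStar_values`; with Kato Thm. 13.4 (2) at `p = 2` BY NAME and
# Gross–Zagier–Kolyvagin: `X₀(W/ℚ_∞)` has finite local length at every height-one `𝔭 ∌ 2` (cell `bsd-wall`, width
# seat `bsd-wall-tp2-p2x-w2`; `--supports stmt-BirchSwinnertonDyer-20308`)

HONEST FRAMING (cell `bsd-wall`): THEOREMS ONLY — no definition, no named fact, no instance, no `sorry`; the
published inputs are DISPLAYED hypotheses (`hES` = Kato (8.1.3)/Ex. 13.3/Thm. 9.7/Thm. 6.6 (1) =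
`Kato2004.exists_eulerSystem_expStar_values`; `h134` = Kato Thm. 13.4 (2) at `p = 2` =
`Kato2004.thm13_4_two_lengthAt_fineSelmerDual_le_of_isEulerSystemClassTwo`; `h17` = Gross–Zagier–Kolyvagin =
`rank_eq_analyticRank_of_analyticRank_le_one`; all def:Prop facts without `_holds`, so every theorem using them is
CONDITIONAL); closes no item; BSD is NOT proved by any of this.

## Why (the gap it fills)

Stub (K2) `stub_katoBoundTwo` of `Cruxes/SignedKatoDivisibilityUpToAtTwo/Lines/colemanrat.lean` (= the `h134` fact
verbatim) and the `∃ s`-clause of stub (C2) `stub_colemanLengthTwo` quantify over GENUINE `2`-adic Euler-system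
classes `s ≠ 0` (Kato's hypothesis (i) of Thm. 13.4, flag `Kato-134-i-two` of the fact's docstring). If no such
class existed the stubs would be closable VACUOUSLY and the line's reduction «K3 = PUB + ONE `2`-adic package»
(`signedKatoDivisibilityUpToAtTwo_of_weakPackageTwo_of_pub`) would be void of content on the `𝐇¹` side. This file
shows — in the kernel, from tree theorems, modulo ONLY Kato's construction fact — that such a class exists whenever
`L(W,1) ≠ 0` and `W[2]` is irreducible (both automatic on the habitat: `r_an = 0`, good supersingular at `2`).

## What is proved

* §1 (Euler-system side, `p = 2`, any finite bad set `S`): `levelToLayerTwo_zero_ne_zero` — for an Euler system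
  `z` on `cyclotomicLevelsRat 2 S`, `z_{0,∅} ≠ 0 ⇒ Cor_{ℚ(μ_4)/ℚ_0}(z_{2,∅}) ≠ 0` (transitivity of corestriction
  `coresLe_comp` + the `2`-power norm relation `IsEulerSystem.cores_p`, no Euler factor); `lift_ne_zero_of_bottom_ne_zero`
  — a Λ-adic class with layer components `Cor(z_{n+2,∅})` is non-zero as soon as `z_{0,∅}` is.
* §2 (value side, ANY prime `p`): `zetaBody_bottom_ne_zero` — for a `ZetaBody W p f ι κ Λ c d a A z x` witness with
  `κ ≠ 0`, `L(W,1) ≠ 0` and the value guard (`(cd,A) = 1`, `dd′ ≡ 1 (A)`, four-cusp factor `R⁻ ≠ 0`), the bottom class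
  `z_{0,∅} ∈ H¹(ℚ, T_pW)` is NON-ZERO: by (C4)+(C5) at `m = 1` (`KatoValue.zetaBody_value_level_one`)
  `Λ_{0,∅}(z_{0,∅}) = 1 ⊗ r₀`, `r₀ = κ · L_{(pA)}(f,1)/Ω⁺_f · R⁻`, and `L_{(pA)}(f,1) ≠ 0` (the removed Euler factors do
  not vanish at `1`, `exists_continuation_changeLevel_of`), `Ω⁺_f > 0`.
* §3 `exists_isEulerSystemClassTwo_ne_zero` — **∃ `s ∈ 𝐇¹_Γ(T₂W)` with `IsEulerSystemClassTwo W hκ I s ∧ s ≠ 0`** for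
  every `W` with `W[2]` irreducible, newform `f`, `L(W,1) ≠ 0`, every cyclotomic `κ`, every pinned `I`, granted `hES`
  (admissible guarded datum: `Kato2004.valueGuard_satisfiable`; lift: `exists_isEulerSystemClassTwo_of_zetaBody`).
* §4 (habitat corollaries) `exists_isEulerSystemClassTwo_ne_zero_of_goodSS` (globally minimal, `r_an = 0`, good
  supersingular at `2`: `P2.irr_two_of_goodSS_two`, `analyticRank_eq_zero_iff_holds`); `…_lengthAt_ne_top` (with
  `h17`: also `ℓ_𝔭(𝐇¹/Λs) < ⊤` at height `≤ 1`, `lengthAt_quotient_span_ne_top_of_gzk`);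
  `fineSelmerDual_lengthAt_ne_top_of_pub` / `…_of_goodSS_of_pub` — **`ℓ_𝔭(X₀(W/ℚ_∞)) < ⊤` at every height-one
  `𝔭 ∌ 2`** for non-CM `W` with `W[2]` irreducible and `r_an = 0`, modulo `h134 + hES + h17` (Kato's Thm. 13.4 (1)
  read off `2` on the `Δ`-trivial component, obtained from clause (2) and the explicit class);
  `stub_katoBoundTwo_hypotheses_inhabited` — all binders of the registered stub (K2) are simultaneously inhabited
  on the habitat (its inline `∃ S z …` is `Kato2004.isEulerSystemClassTwo_iff`).

Not here: anything about the Coleman side of (C2) (reciprocity `j ∘ col = 0`, the cover `ker(X⁺ → X₀) ≤ j(P)`, the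
zeta-value clause `v_𝔭(Col s) ≤ v_𝔭(L♭)`) — the crux's research content at `p = 2`, untouched.

References: [Kato2004Asterisque] (8.1.3) (p. 180), Thm. 9.7 (p. 189), Thm. 6.6 (1) (p. 163), Thm. 12.5 (1) (pp. 221–222),
§13.1 (13.1.1), Ex. 13.3 (pp. 224–225), Thm. 13.4 (p. 226), 13.9 (p. 229); [Rubin2000] Def. 2.1.1;
[Washington1997] §13.1; [MazurTateTeitelbaum1986Invent] §I.8; [BirchSwinnertonDyer1965]; [Darmon2004] Thm. 3.22.
-/

set_option autoImplicit false
-- the Theorems namespace of this sub repeats the summit name by design (D-0017 nested layout)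
set_option linter.dupNamespace false

noncomputable section

open scoped Classical MatrixGroups ModularForm NumberField TensorProduct

open CongruenceSubgroup WeierstrassCurve Field IsDedekindDomain
  Literature.NumberTheory.GaloisRepresentations
  Literature.NumberTheory.EllipticCurves Literature.NumberTheory.EllipticCurves.ModularForms
  Literature.NumberTheory.EllipticCurves.Module Literature.NumberTheory.EllipticCurves.Rank1Residual
  Literature.NumberTheory.EllipticCurves.Kato2004
  Literature.NumberTheory.EllipticCurves.Kato2004.EulerSystemValues ZpExtension

namespace Summit.BirchSwinnertonDyer.BirchSwinnertonDyer.Theorems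

namespace SignedKatoOffTwo.ESClassTwo

/-! ## §1 Euler-system side: the bottom class controls the Λ-adic lift -/

section ESSide

variable (W : WeierstrassCurve ℚ) [W.IsElliptic] [ContinuousSMul ℤ_[2] (W.tateModule 2)]
  [Module.Free ℤ_[2] (W.tateModule 2)] [Module.Finite ℤ_[2] (W.tateModule 2)]
  {κ : ZpExtension ℚ 2} (hκ : κ.IsCyclotomic)

/-- The bottom Euler-system level is the whole Galois group: `Gal(ℚ̄/ℚ(μ_1)) = Γ_ℚ`. [folklore] -/
theorem level_zero_empty (p : ℕ) [Fact p.Prime] (S : Set (HeightOneSpectrum (𝓞 ℚ))) :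
    (cyclotomicLevelsRat p S).level 0 ∅ = ⊤ :=
  (cyclotomicLevelsRat p S).level_bot_empty

/-- `Gal(ℚ̄/ℚ_0) ≤ Gal(ℚ̄/ℚ(μ_1))` (both are `Γ_ℚ`). [folklore] -/
theorem layerSubgroup_zero_le_level_zero_empty (p : ℕ) [Fact p.Prime] (κ' : ZpExtension ℚ p)
    (S : Set (HeightOneSpectrum (𝓞 ℚ))) :
    κ'.layerSubgroup 0 ≤ (cyclotomicLevelsRat p S).level 0 ∅ := by
  rw [level_zero_empty]; exact le_top

/-- **If the bottom class `z_{0,∅} ∈ H¹(ℚ, T₂W)` of an Euler system is non-zero, then so is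
`Cor_{ℚ(μ_4)/ℚ_0}(z_{2,∅})`** — by transitivity of corestriction and the `2`-power norm relation
`Cor_{ℚ(μ_4)/ℚ}(z_{2,∅}) = z_{0,∅}` (no Euler factor in the `p`-direction).
[cite: Rubin2000, Def. 2.1.1] [cite: Kato2004Asterisque, §13.1 (13.1.1) (p. 224)] -/
theorem levelToLayerTwo_zero_ne_zero (S : Set (HeightOneSpectrum (𝓞 ℚ)))
    {z : ∀ (k : ℕ) (r : (cyclotomicLevelsRat 2 S).Ideals),
      H1 (tateRep W 2) ((cyclotomicLevelsRat 2 S).level k r.1)}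
    (hz : IsEulerSystem (cyclotomicLevelsRat 2 S) (tateRep W 2) 2 z)
    (h0 : z 0 (cyclotomicLevelsRat 2 S).idealOne ≠ 0) :
    levelToLayerTwo W hκ S 0 (z 2 (cyclotomicLevelsRat 2 S).idealOne) ≠ 0 := by
  haveI : ((cyclotomicLevelsRat 2 S).level 2 ∅).FiniteIndex :=
    finiteIndex_of_isOpen_of_compactSpace _ ((cyclotomicLevelsRat 2 S).isOpen_level 2 ∅)
  haveI : (κ.layerSubgroup 0).FiniteIndex :=
    finiteIndex_of_isOpen_of_compactSpace _ (κ.isOpen_layerSubgroup 0)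
  letI : Fintype (κ.layerSubgroup 0 ⧸
      ((cyclotomicLevelsRat 2 S).level 2 ∅).subgroupOf (κ.layerSubgroup 0)) := Fintype.ofFinite _
  letI : Fintype ((cyclotomicLevelsRat 2 S).level 0 ∅ ⧸
      (κ.layerSubgroup 0).subgroupOf ((cyclotomicLevelsRat 2 S).level 0 ∅)) := Fintype.ofFinite _
  letI : Fintype ((cyclotomicLevelsRat 2 S).level 0 ∅ ⧸
      ((cyclotomicLevelsRat 2 S).level 2 ∅).subgroupOf ((cyclotomicLevelsRat 2 S).level 0 ∅)) :=
    Fintype.ofFinite _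
  have h₁ : (cyclotomicLevelsRat 2 S).level 2 ∅ ≤ κ.layerSubgroup 0 :=
    hκ.cyclotomicLevelsRat_level_le_layerSubgroup_two S 0
  have h₂ : κ.layerSubgroup 0 ≤ (cyclotomicLevelsRat 2 S).level 0 ∅ :=
    layerSubgroup_zero_le_level_zero_empty 2 κ S
  have hcomp := LinearMap.congr_fun
    (coresLe_comp (tateRep W 2).toTopRep h₁ h₂ ((cyclotomicLevelsRat 2 S).isOpen_level 2 ∅)
      (κ.isOpen_layerSubgroup 0)) (z 2 (cyclotomicLevelsRat 2 S).idealOne)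
  rw [LinearMap.comp_apply] at hcomp
  have hES := hz.cores_p (Nat.zero_le 2) (cyclotomicLevelsRat 2 S).idealOne
  intro h
  apply h0
  rw [← hES]
  have step1 : (cyclotomicLevelsRat 2 S).coresP (tateRep W 2) (Nat.zero_le 2)
        (cyclotomicLevelsRat 2 S).idealOne.1 (z 2 (cyclotomicLevelsRat 2 S).idealOne) =
      coresLe (tateRep W 2).toTopRep (h₁.trans h₂) ((cyclotomicLevelsRat 2 S).isOpen_level 2 ∅)
        (z 2 (cyclotomicLevelsRat 2 S).idealOne) := by
    unfold EulerSystemLevels.coresP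
    rfl
  have step2 : levelToLayerTwo W hκ S 0 (z 2 (cyclotomicLevelsRat 2 S).idealOne) =
      coresLe (tateRep W 2).toTopRep h₁ ((cyclotomicLevelsRat 2 S).isOpen_level 2 ∅)
        (z 2 (cyclotomicLevelsRat 2 S).idealOne) := by
    unfold levelToLayerTwo
    rfl
  rw [step1, ← hcomp, ← step2, h, map_zero]
  rfl

variable {γ : absoluteGaloisGroup ℚ} (I : IwasawaH1Data W 2 κ γ)

/-- **A Λ-adic class whose layer components are `Cor(z_{n+2,∅})` is non-zero as soon as the bottom class
`z_{0,∅}` is**: `proj₀ 𝐲 = Cor_{ℚ(μ_4)/ℚ_0}(z_{2,∅}) ≠ 0`. [cite: Kato2004Asterisque, §13.1 and Thm. 13.4 (pp. 224–226)] -/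
theorem lift_ne_zero_of_bottom_ne_zero (S : Set (HeightOneSpectrum (𝓞 ℚ)))
    {z : ∀ (k : ℕ) (r : (cyclotomicLevelsRat 2 S).Ideals),
      H1 (tateRep W 2) ((cyclotomicLevelsRat 2 S).level k r.1)}
    (hz : IsEulerSystem (cyclotomicLevelsRat 2 S) (tateRep W 2) 2 z)
    (h0 : z 0 (cyclotomicLevelsRat 2 S).idealOne ≠ 0) {y : I.H}
    (hy : ∀ n : ℕ, I.proj n y = levelToLayerTwo W hκ S n (z (n + 2) (cyclotomicLevelsRat 2 S).idealOne)) :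
    y ≠ 0 := by
  intro hy0
  apply levelToLayerTwo_zero_ne_zero W hκ S hz h0
  rw [← hy 0, hy0, map_zero]

end ESSide

/-! ## §2 Value side: the bottom class of Kato's zeta family is non-zero when `L(E,1) ≠ 0` (any `p`) -/

section ValueSide

variable {W : WeierstrassCurve ℚ} [W.IsElliptic] {p : ℕ} [Fact p.Prime]
  [ContinuousSMul ℤ_[p] (W.tateModule p)] [Module.Free ℤ_[p] (W.tateModule p)]
  [Module.Finite ℤ_[p] (W.tateModule p)] {N : ℕ} [NeZero N] {f : CuspForm (Gamma0 N) 2}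
  {ι : (m : ℕ) → (CyclotomicField m ℚ →+* ℂ)} {κ' : ℝ}
  {Λ' : ∀ (k : ℕ) (r : Finset (HeightOneSpectrum (𝓞 ℚ))),
    H1 (tateRep W p) (cycSubgroup p k r) →ₗ[ℤ_[p]] ℚ_[p] ⊗[ℚ] CyclotomicField (cycLevel p k r) ℚ}
  {c d a : ℤ} {A : ℕ}
  {z : ∀ (k : ℕ) (r : (cyclotomicLevelsRat p (badPlaces c d A N)).Ideals),
    H1 (tateRep W p) ((cyclotomicLevelsRat p (badPlaces c d A N)).level k r.1)}
  {x : ∀ (k : ℕ) (r : (cyclotomicLevelsRat p (badPlaces c d A N)).Ideals),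
    CyclotomicField (cycLevel p k r.1) ℚ}

/-- An entire continuation, NON-ZERO AT `1`, of the `(pA)`-depleted `L`-series of the newform of `W`
at the trivial character of a level `m = 1`, when `L(W,1) ≠ 0` (the removed Euler factors do not vanish at
`1`, `eulerFactors_one_ne_zero`). [cite: Kato2004Asterisque, §6.2 (p. 161) and §14 (p. 235)] -/
theorem exists_isDepletedTwistedL_one_ne_zero (hf : IsNewformOf W f) (hL1 : W.entireLFunction 1 ≠ 0)
    {m : ℕ} [NeZero m] (hm : m = 1) (M : ℕ) [NeZero M] :
    ∃ L : ℂ → ℂ, IsDepletedTwistedL f m M (1 : DirichletCharacter ℂ m) L ∧ L 1 ≠ 0 := by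
  subst hm
  haveI : NeZero (1 * M) := ⟨by rw [one_mul]; exact NeZero.ne M⟩
  obtain ⟨L, hLd, hLs, hL0⟩ := exists_continuation_changeLevel_of (M := 1 * M) hf (dvd_mul_right 1 M)
    (1 : DirichletCharacter ℂ 1)
    (exists_continuation_twistedLSeries_one_of_entireLFunction_one_ne_zero hf hL1)
  exact ⟨L, ⟨hLd, hLs⟩, hL0⟩

/-- **The bottom class `z_{0,∅} ∈ H¹(ℚ, T_pW)` of Kato's `(c, d, a(A))`-zeta family is NON-ZERO** when
`L(W,1) ≠ 0`, the constant `κ ≠ 0` and the datum carries the value guard (`(cd, A) = 1`, `dd′ ≡ 1 (A)`, four-cusp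
factor `R⁻ ≠ 0`): by (C4)+(C5) at `m = 1`, `Λ_{0,∅}(z_{0,∅}) = 1 ⊗ r₀` with
`r₀ = κ · L_{(pA)}(f,1)/Ω⁺_f · R⁻ ≠ 0`. Any prime `p`. [cite: Kato2004Asterisque, Thm. 9.7 (p. 189), Thm. 6.6 (1) (p. 163), Thm. 12.5 (1) (pp. 221–222)] -/
theorem zetaBody_bottom_ne_zero (hbody : ZetaBody W p f ι κ' Λ' c d a A z x) (hf : IsNewformOf W f)
    (hκ' : κ' ≠ 0) (hL1 : W.entireLFunction 1 ≠ 0) (hA : 0 < A) (d' : ℤ)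
    (hcd : Int.gcd (c * d) A = 1) (hdd' : d * d' ≡ 1 [ZMOD (A : ℤ)])
    (hR : cuspFactor f true (fun _ ↦ (1 : ℂ)) c d a A d' ≠ 0) :
    z 0 (cyclotomicLevelsRat p (badPlaces c d A N)).idealOne ≠ 0 := by
  haveI : NeZero A := ⟨hA.ne'⟩
  haveI : NeZero (p * A) := ⟨mul_ne_zero (Fact.out : p.Prime).ne_zero hA.ne'⟩
  obtain ⟨Lχ, hLχ, hLχ0⟩ := exists_isDepletedTwistedL_one_ne_zero hf hL1
    (Summit.BirchSwinnertonDyer.Rank1Residual.GaloisImage.KatoValue.cycLevel_zero_empty p) (p * A)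
  obtain ⟨r₀, -, hΛ, hr₀⟩ :=
    Summit.BirchSwinnertonDyer.Rank1Residual.GaloisImage.KatoValue.zetaBody_value_level_one
      hbody d' hcd hdd' hLχ
  have hQ := hf.coeffField_eq_bot
  have hΩ : (plusPeriod f : ℂ) ≠ 0 := by exact_mod_cast (IsNewform0.plusPeriod_pos_holds hf.1 hQ).ne'
  have hr₀0 : r₀ ≠ 0 := by
    intro h
    rw [h, Rat.cast_zero] at hr₀
    have : (κ' : ℂ) * (Lχ 1 / (plusPeriod f : ℂ)) * cuspFactor f true (fun _ ↦ (1 : ℂ)) c d a A d' ≠ 0 :=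
      mul_ne_zero (mul_ne_zero (by exact_mod_cast hκ') (div_ne_zero hLχ0 hΩ)) hR
    exact this hr₀.symm
  intro hz0
  apply hr₀0
  have h1 : (1 : ℚ_[p]) ⊗ₜ[ℚ] algebraMap ℚ (CyclotomicField (cycLevel p 0
      (cyclotomicLevelsRat p (badPlaces c d A N)).idealOne.1) ℚ) r₀ = 0 := by
    rw [← hΛ, hz0]; exact map_zero _
  have h2 := Algebra.TensorProduct.includeRight_injective (R := ℚ) (A := ℚ_[p])
    (B := CyclotomicField (cycLevel p 0 (cyclotomicLevelsRat p (badPlaces c d A N)).idealOne.1) ℚ)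
    (algebraMap ℚ ℚ_[p]).injective
  have h3 : algebraMap ℚ (CyclotomicField (cycLevel p 0
      (cyclotomicLevelsRat p (badPlaces c d A N)).idealOne.1) ℚ) r₀ = 0 := by
    apply h2
    change (1 : ℚ_[p]) ⊗ₜ[ℚ] (algebraMap ℚ _ r₀) = (1 : ℚ_[p]) ⊗ₜ[ℚ] (0 : CyclotomicField _ ℚ)
    rw [h1, TensorProduct.tmul_zero]
  exact (algebraMap ℚ _).injective (by rw [h3, map_zero])

end ValueSide

/-! ## §3 Assembly at `p = 2` -/

section Assembly

variable (W : WeierstrassCurve ℚ) [W.IsElliptic] [ContinuousSMul ℤ_[2] (W.tateModule 2)]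
  [Module.Free ℤ_[2] (W.tateModule 2)] [Module.Finite ℤ_[2] (W.tateModule 2)]
  {κ : ZpExtension ℚ 2} (hκ : κ.IsCyclotomic) {γ : absoluteGaloisGroup ℚ} (I : IwasawaH1Data W 2 κ γ)

/-- **Non-vacuity of hypothesis (i) of Kato Thm. 13.4 (2) at `p = 2`: a NON-ZERO genuine `2`-adic Euler-system
class exists in `𝐇¹_Γ(T₂W)`** whenever `W[2]` is irreducible, `f` is the newform of `W` and `L(W,1) ≠ 0` — GRANTED
Kato's construction fact `Kato2004.exists_eulerSystem_expStar_values` ((8.1.3)/Ex. 13.3 with Thm. 9.7/6.6 (1)).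
Proof: an admissible guarded datum `(c,d,a,A)` exists (`valueGuard_satisfiable`); its zeta family has a Λ-adic lift
`𝐲` (`exists_isEulerSystemClassTwo_of_zetaBody`), whose bottom class is non-zero (`zetaBody_bottom_ne_zero`), hence
`𝐲 ≠ 0` (`lift_ne_zero_of_bottom_ne_zero`). [cite: Kato2004Asterisque, Ex. 13.3 (p. 225), Thm. 12.5 (1) (pp. 221–222), Thm. 13.4 (p. 226), 13.9 (p. 229)] -/
theorem exists_isEulerSystemClassTwo_ne_zero (hES : Kato2004.exists_eulerSystem_expStar_values)
    (hirr : W.HasIrreducibleModPGaloisRep 2) {N : ℕ} [NeZero N] (f : CuspForm (Gamma0 N) 2)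
    (hf : IsNewformOf W f) (hL1 : W.entireLFunction 1 ≠ 0) :
    ∃ s : I.H, Kato2004.IsEulerSystemClassTwo W hκ I s ∧ s ≠ 0 := by
  set ι : (m : ℕ) → (CyclotomicField m ℚ →+* ℂ) :=
    fun m ↦ Classical.choice (inferInstance : Nonempty (CyclotomicField m ℚ →+* ℂ)) with hι
  obtain ⟨κ', hκ'0, Λ', hfam⟩ := hES W 2 hirr f hf ι
  obtain ⟨c, d, a, A, d', hA, hc, hd, hcd, hdd', hR⟩ := valueGuard_satisfiable f hf.1 hf.coeffField_eq_bot 2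
  obtain ⟨z, x, hbody⟩ := hfam c d a A hA hc hd
  have hc0 : c ≠ 0 := by
    rintro rfl
    rw [Int.gcd_zero_left] at hc
    have : (6 * 2 * A : ℤ).natAbs = 12 * A := by push_cast; omega
    omega
  have hd0 : d ≠ 0 := by
    rintro rfl
    rw [Int.gcd_zero_left] at hd
    have : (6 * 2 * (N : ℤ)).natAbs = 12 * N := by push_cast; omega
    have hN := NeZero.ne N
    omega
  have hne : 2 * c.natAbs * d.natAbs * A * N ≠ 0 :=
    mul_ne_zero (mul_ne_zero (mul_ne_zero (mul_ne_zero two_ne_zero (Int.natAbs_ne_zero.mpr hc0))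
      (Int.natAbs_ne_zero.mpr hd0)) hA.ne') (NeZero.ne N)
  obtain ⟨y, hyES, hy⟩ := exists_isEulerSystemClassTwo_of_zetaBody W hκ I f ι κ' Λ' c d a A z x hbody hne
  exact ⟨y, hyES, lift_ne_zero_of_bottom_ne_zero W hκ I (badPlaces c d A N) hbody.1
    (zetaBody_bottom_ne_zero hbody hf hκ'0 hL1 hA d' hcd hdd' hR) hy⟩

end Assembly

/-! ## §4 On the theta habitat of K3 (and beyond): corollaries -/

section Habitat

/-- `L(W,1) ≠ 0` from `r_an(W) = 0`, given a newform for `W` (so that `L(W,s)` is entire; named fact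
`analyticRank_eq_zero_iff`, discharged in the tree). [cite: BirchSwinnertonDyer1965] -/
theorem entireLFunction_one_ne_zero_of_analyticRank_eq_zero (W : WeierstrassCurve ℚ) [W.IsElliptic]
    {N : ℕ} [NeZero N] (f : CuspForm (Gamma0 N) 2) (hf : IsNewformOf W f) (hr : W.analyticRank = 0) :
    W.entireLFunction 1 ≠ 0 :=
  (WeierstrassCurve.analyticRank_eq_zero_iff_holds (W := W)
    (W.hasEntireLFunction_of_cuspCoeff_eq (strictWidthInfty_Gamma0 N) f hf.2)).mp hr

variable (W : WeierstrassCurve ℚ) [W.IsElliptic] [ContinuousSMul ℤ_[2] (W.tateModule 2)]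
  [Module.Free ℤ_[2] (W.tateModule 2)] [Module.Finite ℤ_[2] (W.tateModule 2)]
  {κ : ZpExtension ℚ 2} {γ : absoluteGaloisGroup ℚ}

/-- **On the theta habitat of K3 (indeed for every globally minimal `W` with good supersingular reduction at
`2` and `r_an = 0`) there is a NON-ZERO genuine `2`-adic Euler-system class in `𝐇¹_Γ(T₂W)`** — `W[2]` is
irreducible at a good supersingular `2` (`P2.irr_two_of_goodSS_two`) and `L(W,1) ≠ 0`; GRANTED Kato's construction
fact. So the `∃ s`-clause of stub (C2) and hypothesis (i) of stub (K2) of line `colemanrat` are inhabited on the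
habitat: neither stub is vacuous on the `𝐇¹` side. [cite: Kato2004Asterisque, Ex. 13.3 (p. 225), Thm. 13.4 (p. 226)] -/
theorem exists_isEulerSystemClassTwo_ne_zero_of_goodSS [W.IsGloballyMinimal] (hκ : κ.IsCyclotomic)
    (hES : Kato2004.exists_eulerSystem_expStar_values) (hr : W.analyticRank = 0) (hss : GoodSS W 2)
    {N : ℕ} [NeZero N] (f : CuspForm (Gamma0 N) 2) (hf : IsNewformOf W f) (I : IwasawaH1Data W 2 κ γ) :
    ∃ s : I.H, Kato2004.IsEulerSystemClassTwo W hκ I s ∧ s ≠ 0 :=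
  exists_isEulerSystemClassTwo_ne_zero W hκ I hES
    (Summit.BirchSwinnertonDyer.Rank1Residual.P2.irr_two_of_goodSS_two W hss) f hf
    (entireLFunction_one_ne_zero_of_analyticRank_eq_zero W f hf hr)

/-- **With Gross–Zagier–Kolyvagin the non-zero class also has `ℓ_𝔭(𝐇¹_Γ(T₂W)/Λs) < ⊤` at every prime of
height `≤ 1`** (`lengthAt_quotient_span_ne_top_of_gzk`): the full hypothesis set of stub (K2) / the finiteness
conjunct of stub (C2) is realised on the habitat. [cite: Kato2004Asterisque, Thm. 12.4 (2) (p. 221), Thm. 13.4 (p. 226)]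
[cite: Darmon2004, Thm. 3.22] -/
theorem exists_isEulerSystemClassTwo_ne_zero_lengthAt_ne_top [W.IsGloballyMinimal] (hκ : κ.IsCyclotomic)
    (hES : Kato2004.exists_eulerSystem_expStar_values) (h17 : rank_eq_analyticRank_of_analyticRank_le_one)
    (hr : W.analyticRank = 0) (hss : GoodSS W 2) {N : ℕ} [NeZero N] (f : CuspForm (Gamma0 N) 2)
    (hf : IsNewformOf W f) (hγ : κ.IsTopGenerator γ) (I : IwasawaH1Data W 2 κ γ) :
    ∃ s : I.H, Kato2004.IsEulerSystemClassTwo W hκ I s ∧ s ≠ 0 ∧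
      ∀ 𝔭 : PrimeSpectrum (IwasawaAlgebra 2), 𝔭.asIdeal.height ≤ 1 →
        lengthAt (IwasawaAlgebra 2) (I.H ⧸ Submodule.span (IwasawaAlgebra 2) {s}) 𝔭 ≠ ⊤ := by
  obtain ⟨s, hs, hs0⟩ := exists_isEulerSystemClassTwo_ne_zero_of_goodSS W hκ hES hr hss f hf I
  exact ⟨s, hs, hs0, fun 𝔭 h𝔭 ↦
    SignedKatoOffTwo.lengthAt_quotient_span_ne_top_of_gzk h17 hr hκ hγ I hs0 𝔭 h𝔭⟩

/-- **`X₀(W/ℚ_∞)` has FINITE local length at every height-one prime `𝔭 ∌ 2` of `Λ = ℤ₂⟦X⟧`, for every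
non-CM `W/ℚ` with `W[2]` irreducible and `L(W,1) ≠ 0` (`r_an = 0`), MODULO PRINT**: Kato Thm. 13.4 (2) at `p = 2`
BY NAME (`h134`) applied to the non-zero genuine class of `exists_isEulerSystemClassTwo_ne_zero` (`hES`), whose
`ℓ_𝔭(𝐇¹/Λs)` is finite by Gross–Zagier–Kolyvagin (`h17`). (Kato's Thm. 13.4 (1) "`𝐇²(T)` is torsion" read off `2` on
the `Δ`-trivial component, as a consequence of clause (2) + the explicit class; nothing at `𝔭 ∋ 2`.)
[cite: Kato2004Asterisque, Thm. 13.4 (1)(2) (p. 226), Thm. 12.4 (p. 221)] [cite: Darmon2004, Thm. 3.22] -/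
theorem fineSelmerDual_lengthAt_ne_top_of_pub (hκ : κ.IsCyclotomic)
    (h134 : Kato2004.thm13_4_two_lengthAt_fineSelmerDual_le_of_isEulerSystemClassTwo)
    (hES : Kato2004.exists_eulerSystem_expStar_values) (h17 : rank_eq_analyticRank_of_analyticRank_le_one)
    (hcm : ¬ W.HasCM) (hirr : W.HasIrreducibleModPGaloisRep 2) (hr : W.analyticRank = 0)
    {N : ℕ} [NeZero N] (f : CuspForm (Gamma0 N) 2) (hf : IsNewformOf W f) (hγ : κ.IsTopGenerator γ)
    (FB : W.FineSelmerDualData κ γ) (𝔭 : PrimeSpectrum (IwasawaAlgebra 2)) (h𝔭 : 𝔭.asIdeal.height = 1)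
    (h2 : PowerSeries.C (2 : ℤ_[2]) ∉ 𝔭.asIdeal) :
    lengthAt (IwasawaAlgebra 2) FB.X 𝔭 ≠ ⊤ := by
  obtain ⟨I⟩ := Kato2004.nonempty_iwasawaH1Data_holds W 2 κ γ hκ hγ
  obtain ⟨s, hs, hs0⟩ := exists_isEulerSystemClassTwo_ne_zero W hκ I hES hirr f hf
    (entireLFunction_one_ne_zero_of_analyticRank_eq_zero W f hf hr)
  exact ne_top_of_le_ne_top (SignedKatoOffTwo.lengthAt_quotient_span_ne_top_of_gzk h17 hr hκ hγ I hs0 𝔭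
    (le_of_eq h𝔭)) (h134 W hcm κ γ hκ hγ I FB s hs hs0 𝔭 h𝔭 h2)

/-- **The same on the theta habitat of K3** (non-CM, `r_an = 0`, good supersingular at `2`; `a₂ = 0` not needed):
`ℓ_𝔭(X₀(E/ℚ_∞)) < ⊤` at every height-one `𝔭 ∌ 2`, modulo print (`h134`, `hES`, `h17`).
[cite: Kato2004Asterisque, Thm. 13.4 (1)(2) (p. 226)] [cite: Darmon2004, Thm. 3.22] -/
theorem fineSelmerDual_lengthAt_ne_top_of_goodSS_of_pub [W.IsGloballyMinimal] (hκ : κ.IsCyclotomic)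
    (h134 : Kato2004.thm13_4_two_lengthAt_fineSelmerDual_le_of_isEulerSystemClassTwo)
    (hES : Kato2004.exists_eulerSystem_expStar_values) (h17 : rank_eq_analyticRank_of_analyticRank_le_one)
    (hcm : ¬ W.HasCM) (hr : W.analyticRank = 0) (hss : GoodSS W 2)
    {N : ℕ} [NeZero N] (f : CuspForm (Gamma0 N) 2) (hf : IsNewformOf W f) (hγ : κ.IsTopGenerator γ)
    (FB : W.FineSelmerDualData κ γ) (𝔭 : PrimeSpectrum (IwasawaAlgebra 2)) (h𝔭 : 𝔭.asIdeal.height = 1)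
    (h2 : PowerSeries.C (2 : ℤ_[2]) ∉ 𝔭.asIdeal) :
    lengthAt (IwasawaAlgebra 2) FB.X 𝔭 ≠ ⊤ :=
  fineSelmerDual_lengthAt_ne_top_of_pub W hκ h134 hES h17 hcm
    (Summit.BirchSwinnertonDyer.Rank1Residual.P2.irr_two_of_goodSS_two W hss) hr f hf hγ FB 𝔭 h𝔭 h2

/-- **All hypotheses of the registered stub (K2) `stub_katoBoundTwo` are SIMULTANEOUSLY inhabited on the habitat**
(pinned `I`, `Y`, a genuine `2`-adic Euler-system class `s ≠ 0`; the inline `∃ S z …` of the stub is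
`Kato2004.isEulerSystemClassTwo_iff`): the stub cannot be closed vacuously. GRANTED Kato's construction fact.
[cite: Kato2004Asterisque, §12.2 (p. 220), Ex. 13.3 (p. 225), Thm. 13.4 (p. 226)] -/
theorem stub_katoBoundTwo_hypotheses_inhabited [W.IsGloballyMinimal] (hκ : κ.IsCyclotomic)
    (hES : Kato2004.exists_eulerSystem_expStar_values) (hr : W.analyticRank = 0) (hss : GoodSS W 2)
    {N : ℕ} [NeZero N] (f : CuspForm (Gamma0 N) 2) (hf : IsNewformOf W f) (hγ : κ.IsTopGenerator γ) :
    ∃ (I : IwasawaH1Data W 2 κ γ) (_ : W.FineSelmerDualData κ γ) (s : I.H),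
      (∃ (S : Set (HeightOneSpectrum (𝓞 ℚ))) (_ : S.Finite)
          (z : ∀ (k : ℕ) (r : (cyclotomicLevelsRat 2 S).Ideals),
            H1 (tateRep W 2) ((cyclotomicLevelsRat 2 S).level k r.1)),
          IsEulerSystem (cyclotomicLevelsRat 2 S) (tateRep W 2) 2 z ∧
          (∀ (k : ℕ) (r : (cyclotomicLevelsRat 2 S).Ideals),
            z k r ∈ integralH1 (tateRep W 2) 2 ((cyclotomicLevelsRat 2 S).level k r.1)) ∧
          ∀ n : ℕ, I.proj n s =
            Kato2004.levelToLayerTwo W hκ S n (z (n + 2) (cyclotomicLevelsRat 2 S).idealOne)) ∧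
      s ≠ 0 := by
  obtain ⟨I⟩ := Kato2004.nonempty_iwasawaH1Data_holds W 2 κ γ hκ hγ
  obtain ⟨Y⟩ := W.nonempty_fineSelmerDualData (κ := κ) hγ
  obtain ⟨s, hs, hs0⟩ := exists_isEulerSystemClassTwo_ne_zero_of_goodSS W hκ hES hr hss f hf I
  exact ⟨I, Y, s, (Kato2004.isEulerSystemClassTwo_iff W hκ I s).mp hs, hs0⟩

end Habitat

end SignedKatoOffTwo.ESClassTwo

end Summit.BirchSwinnertonDyer.BirchSwinnertonDyer.Theorems

end
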